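import Mathlib
import Literature.MathematicalPhysics.QuantumFieldTheory.Balaban1983to89.Beta.TorusG0Decay

/-!
# Beta / TorusG0Kernel — `G₀ = (−Δ^η + a Q*Q)⁻¹` AS A MATRIX on the torus type: existence, symmetry, the `ℓ²`
bound, set-to-set decay and the ENTRY bound `|G₀(x,y)| ≤ (2/min(2,a)) e^{−δ·dist_η(x,y)}`

HONEST FRAMING (verbatim, page 1 of everything this cell writes): discharging `BetaPertH` makes Bałaban's UV
stability UNCONDITIONAL — a real constructive-QFT result; it is NOT the continuum limit and NOT the Clay problem.
Gloss (BETA-SPEC v1.9b l. 17–18, G-ref2-14 (a) / G-ref2-20 (a), verbatim): «UNCONDITIONAL» in [Balaban1989LargeFieldII]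
(B16, CMP 122) p. 355's interval-hypothesis sense ONLY (`FlowStepRuns.p355Unconditional_of_partialSums` keeps `hnodes`);
the located leaves G-adv3-2 (left inequality of (0.1)/(2.50), d = 4), G-adv3-1 (U2 transfer of B14 Cor. 3's lower
bound) and `SecondExpLeaf` REMAIN.  Gloss 2 (BETA-SPEC v1.9e 22:38Z, beta-ref C-beta-78, BINDING, verbatim): «UNCONDITIONAL» =
`Beta.Assembly.EventualForm`-unconditional — the END statement with the interval hypothesis removed, (0.31) in DEFECTED form
on all lattices (`PrefixAbsorption.thm2Defected_of_eventualForm`), admissible couplings shrunk to g ≤ g⋆; NOT «B12 Theorem 2 as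
printed» (that needs (AF-0s) or (AF-0-L) ∀k at L ≥ L₁ in addition: `eventualForm_not_thm2Printed`, RULING (R6)); never the
continuum limit / mass gap / Clay.  THIS MODULE discharges nothing of that and makes NO UV-stability claim at all: it
is a Mathlib-elementary kernel certificate (v1.0.1/v1.0.2 = v1 + this paragraph, docstring-only — beta-ref R129/R150,
ref2 G-ref2-20 (a); no declaration changed).

SCOPE.  Mathlib-elementary COROLLARIES of the sibling `Beta/TorusG0Decay` (p179998, commit 2801891c867c);
nothing printed by Bałaban is asserted, no hypothesis is a quotation.  There, on `T_η = Tor (fine (n+1) M)` with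
periods `(n+1)M_μ ≥ 3`, the operator `H = torusOp n M a` (`= −Δ^η + aQ*Q` in the site basis, `torusOp_mulVec`)
was shown coercive (`coercive_torus`: `min(2,a)‖ω‖² ≤ ⟨ω,Hω⟩`) and every solution of `Hv = g` was shown to decay
away from the support of `g` (`setDecay_torus`).  THIS MODULE turns those statements about solutions into
statements about the inverse matrix:

* §1 `torusOp_transpose` (`H` is symmetric), `dotProduct_torusOp_pos` (`⟨ω,Hω⟩ > 0` for `ω ≠ 0`, `a > 0`),
  `torusOp_mulVec_injective`, `isUnit_torusOp` / `isUnit_torusOp_det` (so `H` is invertible for EVERY mesh);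
* §2 `G0 n M a := (torusOp n M a)⁻¹` with `torusOp_mul_G0 / G0_mul_torusOp = 1`, `torusOp_mulVec_G0`
  (`H (G₀ g) = g`), `G0_mulVec_torusOp`, `eq_G0_mulVec` (uniqueness of solutions), `G0_transpose`;
* §3 `G0_form_ge` (`min(2,a)‖G₀g‖² ≤ ⟨g, G₀ g⟩`, in particular `⟨g,G₀g⟩ ≥ 0`), `G0_sq_le`
  (`‖G₀ g‖² ≤ (1/min(2,a))² ‖g‖²`), `G0_entry_abs_le` (`|G₀(x,y)| ≤ 1/min(2,a)`), `G0_diag_pos` (`G₀(x,x) > 0`);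
* §4 `G0_setDecay` = `setDecay_torus` for `v := G₀ g` (no solution hypothesis left):
  `Σ_{x∈S} (G₀g)(x)² ≤ (2/min(2,a))² e^{−2δR} Σ g²` for `g` supported in `T ≠ ∅`, `edist(S,T) ≥ R`;
* §5 **`G0_entry_bound`**: `|G₀(x,y)| ≤ (2/min(2,a)) · e^{−δ·edist(x,y)}` for every `0 ≤ δ ≤ 1` with the `η`-FREE
  smallness `2d·δ² + a(e^δ − 1) ≤ min(2,a)/2` (and `G0_entry_bound_ldist`, the same in lattice units:
  exponent `−(δ/(n+1))·ldist(x,y)`), uniformly in the mesh `η = 1/(n+1)` and in the periods.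

NORMALISATION (documentation only, no theorem): `G0` is the inverse MATRIX in the site basis, i.e. the kernel of
`H⁻¹` w.r.t. counting measure on `T_η`; a kernel w.r.t. the `η^d`-weighted measure (`(G₀f)(x) = Σ_y η^d G₀(x,y) f(y)`)
is `η^{−d} · G0 x y`.  WHAT IT DOES NOT GIVE: the short-distance GAIN of the true Green's function (entries of the
inverse of an operator of order `η⁻²` are `O(η²)`-small near the diagonal in `d ≥ 3`; here only `≤ 1/min(2,a)` /
`≤ (2/min(2,a))e^{−δ·edist}` is proved — an honest `ℓ²`-type bound, not a B5 (1.110)-type pointwise estimate);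
nothing about non-local members of Bałaban's class `𝒦_k`, covariant Laplacians, or periods `≤ 2`.
B5 = T. Bałaban, Commun. Math. Phys. 95 (1984) 17–40 [Balaban1984PropagatorsI] is CONTEXT only (the operator of
(1.18) p. 20).  Device references as in the imported modules (Combes–Thomas [CombesThomas1973, §II]).  Unit
`b2b-balaban-pv23-g3` (surge node prover #23, gen 3; journal claim BETA-TORUS-G0-KERNEL-ENTRIES); census
C-pv23g3-10 (GAPS.md); staged byte-identically under `HOME/lean/BalabanYm4/`.  Value = kernel certificate, NOT
summit progress.
-/

open Finset Matrix

namespace Literature.MathematicalPhysics.QuantumFieldTheory.Balaban1983to89.Beta.TorusG0Kernel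

open B5Prop11Plancherel (Tor fine unitVec)
open CombesThomasForm (lap lap_apply)
open CombesThomasFormOp (pointwise_of_setDecay)
open TorusG0Decay (torusOp coupling coupling_symm coercive_torus setDecay_torus edist ldist ldist_self)

noncomputable section

/-! ## §1  Symmetry, positivity, invertibility of `H = torusOp n M a` -/

section Symm

variable {ι : Type*} [Fintype ι] [DecidableEq ι]

/-- a graph Laplacian with symmetric coefficients is a symmetric matrix (entrywise). [folklore] -/
theorem lap_comm (c : ι → ι → ℝ) (hc : ∀ j k, c j k = c k j) (j k : ι) : lap c k j = lap c j k := by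
  simp only [lap_apply]
  by_cases h : j = k
  · subst h; rfl
  · rw [if_neg h, if_neg (Ne.symm h), hc k j]

end Symm

variable {d : ℕ} (n : ℕ) (M : Fin d → ℕ) [hM : ∀ μ, NeZero (M μ)]

/-- `H = −Δ^η + aQ*Q` is symmetric: `Hᵀ = H`. [folklore] -/
theorem torusOp_transpose (a : ℝ) : (torusOp n M a)ᵀ = torusOp n M a := by
  ext j k
  simp only [transpose_apply, torusOp]
  congr 1
  · exact lap_comm _ (coupling_symm _ _) j k
  · exact Finset.sum_congr rfl fun b _ => by ring

/-- `⟨ω, ω⟩ > 0` for `ω ≠ 0` (real vectors). [folklore] -/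
theorem dotProduct_self_pos' {ι : Type*} [Fintype ι] {ω : ι → ℝ} (hω : ω ≠ 0) : 0 < ω ⬝ᵥ ω := by
  have h0 : 0 ≤ ω ⬝ᵥ ω := Finset.sum_nonneg fun _ _ => mul_self_nonneg _
  rcases h0.lt_or_eq with h | h
  · exact h
  · exfalso; apply hω
    have hz : ∀ i ∈ (univ : Finset ι), ω i * ω i = 0 :=
      (Finset.sum_eq_zero_iff_of_nonneg fun i _ => mul_self_nonneg (ω i)).mp h.symm
    funext i
    exact mul_self_eq_zero.mp (hz i (mem_univ i))

/-- strict positivity of the form: `0 < ⟨ω, Hω⟩` for `ω ≠ 0`, `a > 0`, periods `≥ 3`. [folklore] -/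
theorem dotProduct_torusOp_pos (h3 : ∀ μ, 3 ≤ fine (n + 1) M μ) {a : ℝ} (ha : 0 < a)
    {ω : Tor (fine (n + 1) M) → ℝ} (hω : ω ≠ 0) : 0 < ω ⬝ᵥ (torusOp n M a).mulVec ω :=
  lt_of_lt_of_le (mul_pos (lt_min two_pos ha) (dotProduct_self_pos' hω)) (coercive_torus n M h3 ha.le ω)

/-- `H` has trivial kernel: `v ↦ Hv` is injective. [folklore] -/
theorem torusOp_mulVec_injective (h3 : ∀ μ, 3 ≤ fine (n + 1) M μ) {a : ℝ} (ha : 0 < a) :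
    Function.Injective (torusOp n M a).mulVec := by
  intro v w hvw
  by_contra hne
  have hpos := dotProduct_torusOp_pos n M h3 ha (sub_ne_zero.mpr hne)
  rw [Matrix.mulVec_sub, hvw, sub_self, dotProduct_zero] at hpos
  exact lt_irrefl _ hpos

/-- `H` is an invertible matrix, for EVERY mesh `η = 1/(n+1)` and all periods `≥ 3`. [folklore] -/
theorem isUnit_torusOp (h3 : ∀ μ, 3 ≤ fine (n + 1) M μ) {a : ℝ} (ha : 0 < a) : IsUnit (torusOp n M a) :=
  Matrix.mulVec_injective_iff_isUnit.mp (torusOp_mulVec_injective n M h3 ha)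

/-- `det H` is a unit (nonzero). [folklore] -/
theorem isUnit_torusOp_det (h3 : ∀ μ, 3 ≤ fine (n + 1) M μ) {a : ℝ} (ha : 0 < a) :
    IsUnit (torusOp n M a).det :=
  (Matrix.isUnit_iff_isUnit_det _).mp (isUnit_torusOp n M h3 ha)

/-! ## §2  `G₀ := H⁻¹` -/

/-- **`G₀ = (−Δ^η + aQ*Q)⁻¹`** as a matrix in the site basis of `T_η` (Mathlib's nonsingular inverse of `torusOp`).
[folklore] -/
def G0 (a : ℝ) : Matrix (Tor (fine (n + 1) M)) (Tor (fine (n + 1) M)) ℝ := (torusOp n M a)⁻¹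

/-- `H G₀ = 1`. [folklore] -/
theorem torusOp_mul_G0 (h3 : ∀ μ, 3 ≤ fine (n + 1) M μ) {a : ℝ} (ha : 0 < a) :
    torusOp n M a * G0 n M a = 1 :=
  Matrix.mul_nonsing_inv _ (isUnit_torusOp_det n M h3 ha)

/-- `G₀ H = 1`. [folklore] -/
theorem G0_mul_torusOp (h3 : ∀ μ, 3 ≤ fine (n + 1) M μ) {a : ℝ} (ha : 0 < a) :
    G0 n M a * torusOp n M a = 1 :=
  Matrix.nonsing_inv_mul _ (isUnit_torusOp_det n M h3 ha)

/-- `H (G₀ g) = g`: `G₀ g` solves the equation. [folklore] -/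
theorem torusOp_mulVec_G0 (h3 : ∀ μ, 3 ≤ fine (n + 1) M μ) {a : ℝ} (ha : 0 < a)
    (g : Tor (fine (n + 1) M) → ℝ) : (torusOp n M a).mulVec ((G0 n M a).mulVec g) = g := by
  rw [Matrix.mulVec_mulVec, torusOp_mul_G0 n M h3 ha, Matrix.one_mulVec]

/-- `G₀ (H v) = v`. [folklore] -/
theorem G0_mulVec_torusOp (h3 : ∀ μ, 3 ≤ fine (n + 1) M μ) {a : ℝ} (ha : 0 < a)
    (v : Tor (fine (n + 1) M) → ℝ) : (G0 n M a).mulVec ((torusOp n M a).mulVec v) = v := by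
  rw [Matrix.mulVec_mulVec, G0_mul_torusOp n M h3 ha, Matrix.one_mulVec]

/-- uniqueness: every solution of `H v = g` is `G₀ g`. [folklore] -/
theorem eq_G0_mulVec (h3 : ∀ μ, 3 ≤ fine (n + 1) M μ) {a : ℝ} (ha : 0 < a)
    {g v : Tor (fine (n + 1) M) → ℝ} (hv : (torusOp n M a).mulVec v = g) : v = (G0 n M a).mulVec g := by
  rw [← hv, G0_mulVec_torusOp n M h3 ha]

/-- `G₀` is symmetric. [folklore] -/
theorem G0_transpose (a : ℝ) : (G0 n M a)ᵀ = G0 n M a := by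
  rw [G0, Matrix.transpose_nonsing_inv, torusOp_transpose]

/-- `(G₀ δ_y)(x) = G₀(x,y)`. [folklore] -/
theorem G0_mulVec_single (a : ℝ) (x y : Tor (fine (n + 1) M)) :
    (G0 n M a).mulVec (Pi.single y 1) x = G0 n M a x y := by
  classical
  simp only [Matrix.mulVec, dotProduct, Pi.single_apply, mul_ite, mul_one, mul_zero, Finset.sum_ite_eq',
    Finset.mem_univ, if_true]

/-- `Σ_j (δ_y)_j² = 1`. [folklore] -/
theorem sum_single_sq (y : Tor (fine (n + 1) M)) : ∑ j, (Pi.single y (1 : ℝ) : Tor (fine (n + 1) M) → ℝ) j ^ 2 = 1 := by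
  classical
  simp only [Pi.single_apply, ite_pow, one_pow, zero_pow two_ne_zero, Finset.sum_ite_eq', Finset.mem_univ, if_true]

/-! ## §3  Form positivity and the `ℓ²` bound -/

/-- `min(2,a) ‖G₀ g‖² ≤ ⟨g, G₀ g⟩` (coercivity transported to the inverse); in particular `⟨g, G₀ g⟩ ≥ 0`.
[folklore] -/
theorem G0_form_ge (h3 : ∀ μ, 3 ≤ fine (n + 1) M μ) {a : ℝ} (ha : 0 < a) (g : Tor (fine (n + 1) M) → ℝ) :
    min 2 a * ((G0 n M a).mulVec g ⬝ᵥ (G0 n M a).mulVec g) ≤ g ⬝ᵥ (G0 n M a).mulVec g := by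
  have h := coercive_torus n M h3 ha.le ((G0 n M a).mulVec g)
  rw [torusOp_mulVec_G0 n M h3 ha] at h
  rwa [dotProduct_comm g]

/-- `⟨g, G₀ g⟩ ≥ 0`. [folklore] -/
theorem G0_form_nonneg (h3 : ∀ μ, 3 ≤ fine (n + 1) M μ) {a : ℝ} (ha : 0 < a) (g : Tor (fine (n + 1) M) → ℝ) :
    0 ≤ g ⬝ᵥ (G0 n M a).mulVec g :=
  le_trans (mul_nonneg (lt_min two_pos ha).le (Finset.sum_nonneg fun _ _ => mul_self_nonneg _))
    (G0_form_ge n M h3 ha g)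

/-- **the `ℓ²` bound** `‖G₀ g‖² ≤ (1/min(2,a))² ‖g‖²`, i.e. `‖G₀‖_{ℓ²→ℓ²} ≤ 1/min(2,a)`, for every mesh. [folklore] -/
theorem G0_sq_le (h3 : ∀ μ, 3 ≤ fine (n + 1) M μ) {a : ℝ} (ha : 0 < a) (g : Tor (fine (n + 1) M) → ℝ) :
    ∑ x, ((G0 n M a).mulVec g x) ^ 2 ≤ (1 / min 2 a) ^ 2 * ∑ x, g x ^ 2 := by
  have hσ : 0 < min 2 a := lt_min two_pos ha
  have hS0 : 0 ≤ ∑ x, ((G0 n M a).mulVec g x) ^ 2 := Finset.sum_nonneg fun x _ => sq_nonneg _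
  have hT0 : 0 ≤ ∑ x, g x ^ 2 := Finset.sum_nonneg fun x _ => sq_nonneg _
  -- σ S ≤ ⟨v, g⟩
  have hmain : min 2 a * ∑ x, ((G0 n M a).mulVec g x) ^ 2 ≤ ∑ x, (G0 n M a).mulVec g x * g x := by
    have h := G0_form_ge n M h3 ha g
    rw [dotProduct_comm g] at h
    have e1 : (G0 n M a).mulVec g ⬝ᵥ (G0 n M a).mulVec g = ∑ x, ((G0 n M a).mulVec g x) ^ 2 :=
      Finset.sum_congr rfl fun x _ => by ring
    have e2 : (G0 n M a).mulVec g ⬝ᵥ g = ∑ x, (G0 n M a).mulVec g x * g x := rfl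
    rw [e1, e2] at h
    exact h
  -- Cauchy–Schwarz
  have hCS : (∑ x, (G0 n M a).mulVec g x * g x) ^ 2 ≤ (∑ x, ((G0 n M a).mulVec g x) ^ 2) * ∑ x, g x ^ 2 :=
    Finset.sum_mul_sq_le_sq_mul_sq univ _ _
  by_cases hS' : ∑ x, ((G0 n M a).mulVec g x) ^ 2 = 0
  · rw [hS']; positivity
  · have hSpos : 0 < ∑ x, ((G0 n M a).mulVec g x) ^ 2 := lt_of_le_of_ne hS0 (Ne.symm hS')
    have h1 : (min 2 a * ∑ x, ((G0 n M a).mulVec g x) ^ 2) ^ 2 ≤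
        (∑ x, ((G0 n M a).mulVec g x) ^ 2) * ∑ x, g x ^ 2 :=
      (pow_le_pow_left₀ (by positivity) hmain 2).trans hCS
    have h2 : (min 2 a) ^ 2 * ∑ x, ((G0 n M a).mulVec g x) ^ 2 ≤ ∑ x, g x ^ 2 := by
      have e : (min 2 a * ∑ x, ((G0 n M a).mulVec g x) ^ 2) ^ 2 =
          ((min 2 a) ^ 2 * ∑ x, ((G0 n M a).mulVec g x) ^ 2) * ∑ x, ((G0 n M a).mulVec g x) ^ 2 := by ring
      rw [e, mul_comm (∑ x, ((G0 n M a).mulVec g x) ^ 2) (∑ x, g x ^ 2)] at h1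
      exact le_of_mul_le_mul_right h1 hSpos
    calc ∑ x, ((G0 n M a).mulVec g x) ^ 2 = (1 / min 2 a) ^ 2 * ((min 2 a) ^ 2 * ∑ x, ((G0 n M a).mulVec g x) ^ 2) := by
          field_simp
      _ ≤ (1 / min 2 a) ^ 2 * ∑ x, g x ^ 2 := mul_le_mul_of_nonneg_left h2 (by positivity)

/-- crude entry bound `|G₀(x,y)| ≤ 1/min(2,a)` (from the `ℓ²` bound with `g = δ_y`). [folklore] -/
theorem G0_entry_abs_le (h3 : ∀ μ, 3 ≤ fine (n + 1) M μ) {a : ℝ} (ha : 0 < a) (x y : Tor (fine (n + 1) M)) :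
    |G0 n M a x y| ≤ 1 / min 2 a := by
  classical
  have hσ : 0 < min 2 a := lt_min two_pos ha
  have h := G0_sq_le n M h3 ha (Pi.single y 1)
  rw [sum_single_sq, mul_one] at h
  have hx : ((G0 n M a).mulVec (Pi.single y 1) x) ^ 2 ≤ ∑ x', ((G0 n M a).mulVec (Pi.single y 1) x') ^ 2 :=
    Finset.single_le_sum (fun x' _ => sq_nonneg _) (mem_univ x)
  rw [G0_mulVec_single] at hx
  exact abs_le_of_sq_le_sq' (hx.trans h) (by positivity) |> fun h' => abs_le.mpr h'

/-- the diagonal entries are strictly positive: `G₀(x,x) > 0`. [folklore] -/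
theorem G0_diag_pos (h3 : ∀ μ, 3 ≤ fine (n + 1) M μ) {a : ℝ} (ha : 0 < a) (x : Tor (fine (n + 1) M)) :
    0 < G0 n M a x x := by
  classical
  have hσ : 0 < min 2 a := lt_min two_pos ha
  have hform := G0_form_ge n M h3 ha (Pi.single x 1)
  have e : (Pi.single x (1 : ℝ) : Tor (fine (n + 1) M) → ℝ) ⬝ᵥ (G0 n M a).mulVec (Pi.single x 1) = G0 n M a x x := by
    simp only [dotProduct, Pi.single_apply, ite_mul, one_mul, zero_mul, Finset.sum_ite_eq', Finset.mem_univ,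
      if_true, G0_mulVec_single]
  rw [e] at hform
  have hv : (G0 n M a).mulVec (Pi.single x 1) ≠ 0 := by
    intro h0
    have h1 := torusOp_mulVec_G0 n M h3 ha (Pi.single x (1 : ℝ))
    rw [h0, Matrix.mulVec_zero] at h1
    have h2 := congrFun h1 x
    simp at h2
  exact lt_of_lt_of_le (mul_pos hσ (dotProduct_self_pos' hv)) hform

/-! ## §4  Set-to-set decay of `G₀` -/

/-- **Set-to-set decay of `G₀`** (`setDecay_torus` with the solution hypothesis discharged by `v := G₀ g`): for
`a > 0`, periods `≥ 3`, `0 ≤ δ ≤ 1`, `2d·δ² + a(e^δ − 1) ≤ min(2,a)/2`, `g` supported in `T ≠ ∅` and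
`edist(S,T) ≥ R`: `Σ_{x∈S} (G₀ g)(x)² ≤ (2/min(2,a))² e^{−2δR} Σ_x g(x)²`, uniformly in the mesh.
[cite: CombesThomas1973, §II] [folklore] -/
theorem G0_setDecay (h3 : ∀ μ, 3 ≤ fine (n + 1) M μ) {a δ : ℝ} (ha : 0 < a) (hδ0 : 0 ≤ δ) (hδ1 : δ ≤ 1)
    (hsmall : 2 * (d : ℝ) * δ ^ 2 + a * (Real.exp δ - 1) ≤ min 2 a / 2)
    (S T : Finset (Tor (fine (n + 1) M))) (hT : T.Nonempty) (R : ℝ)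
    (hR : ∀ x ∈ S, ∀ t ∈ T, R ≤ edist n M x t)
    (g : Tor (fine (n + 1) M) → ℝ) (hg : ∀ x, x ∉ T → g x = 0) :
    ∑ x ∈ S, ((G0 n M a).mulVec g x) ^ 2 ≤ (2 / min 2 a) ^ 2 * Real.exp (-(2 * (δ * R))) * ∑ x, g x ^ 2 :=
  setDecay_torus n M h3 ha hδ0 hδ1 hsmall S T hT R hR g _ hg (torusOp_mulVec_G0 n M h3 ha g)

/-! ## §5  The entry bound -/

/-- **Exponential decay of the entries of `G₀`, uniformly in the mesh**: for `a > 0`, periods `(n+1)M_μ ≥ 3`,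
`0 ≤ δ ≤ 1` with `2d·δ² + a(e^δ − 1) ≤ min(2,a)/2`:  `|G₀(x,y)| ≤ (2/min(2,a)) · e^{−δ · edist(x,y)}`, where
`edist = η · (sup circular lattice distance)` is the physical torus distance. [cite: CombesThomas1973, §II] [folklore] -/
theorem G0_entry_bound (h3 : ∀ μ, 3 ≤ fine (n + 1) M μ) {a δ : ℝ} (ha : 0 < a) (hδ0 : 0 ≤ δ) (hδ1 : δ ≤ 1)
    (hsmall : 2 * (d : ℝ) * δ ^ 2 + a * (Real.exp δ - 1) ≤ min 2 a / 2) (x y : Tor (fine (n + 1) M)) :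
    |G0 n M a x y| ≤ 2 / min 2 a * Real.exp (-(δ * edist n M x y)) := by
  classical
  have hσ : 0 < min 2 a := lt_min two_pos ha
  have hyy : edist n M y y = 0 := by simp [TorusG0Decay.edist, ldist_self]
  have hdec := G0_setDecay n M h3 ha hδ0 hδ1 hsmall {x} {y} (Finset.singleton_nonempty y) (edist n M x y)
    (fun x' hx' t ht => by rw [Finset.mem_singleton] at hx' ht; rw [hx', ht]) (Pi.single y 1)
    (fun j hj => by rw [Finset.mem_singleton] at hj; simp [hj])
  have key : ∑ i' ∈ ({x} : Finset (Tor (fine (n + 1) M))), ((G0 n M a).mulVec (Pi.single y 1) i') ^ 2 ≤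
      (2 / min 2 a) ^ 2 * Real.exp (-(2 * (δ * edist n M x y - δ * edist n M y y))) *
        ∑ j, (Pi.single y (1 : ℝ) : Tor (fine (n + 1) M) → ℝ) j ^ 2 := by
    rw [hyy, mul_zero, sub_zero]; exact hdec
  have h : |(G0 n M a).mulVec (Pi.single y 1) x| ≤
      2 / min 2 a * Real.exp (-(δ * edist n M x y - δ * edist n M y y)) :=
    pointwise_of_setDecay (min 2 a) hσ (fun j => δ * edist n M j y) _ x y key
  rw [hyy, mul_zero, sub_zero, G0_mulVec_single] at h
  exact h

/-- the same bound in LATTICE units: `|G₀(x,y)| ≤ (2/min(2,a)) · e^{−(δ/(n+1)) · ldist(x,y)}` (`ldist` = sup circular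
lattice distance on `Π_μ ℤ/((n+1)M_μ)`; decay length `η⁻¹/δ` sites = `1/δ` in physical units). [folklore] -/
theorem G0_entry_bound_ldist (h3 : ∀ μ, 3 ≤ fine (n + 1) M μ) {a δ : ℝ} (ha : 0 < a) (hδ0 : 0 ≤ δ) (hδ1 : δ ≤ 1)
    (hsmall : 2 * (d : ℝ) * δ ^ 2 + a * (Real.exp δ - 1) ≤ min 2 a / 2) (x y : Tor (fine (n + 1) M)) :
    |G0 n M a x y| ≤ 2 / min 2 a * Real.exp (-(δ / ((n : ℝ) + 1) * ldist (fine (n + 1) M) x y)) := by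
  have h := G0_entry_bound n M h3 ha hδ0 hδ1 hsmall x y
  have e : δ * edist n M x y = δ / ((n : ℝ) + 1) * ldist (fine (n + 1) M) x y := by
    simp only [TorusG0Decay.edist]; ring
  rw [e] at h
  exact h

end

/-! ## Sanity instance (non-vacuity of the hypotheses) -/

section
open B5Prop11Plancherel (fine)

/-- the period hypothesis holds e.g. for `d = 1`, `n = 0` (unit mesh) and `M = 3`: `fine 1 M μ = 3 ≥ 3`; so
`isUnit_torusOp` applies and `H = −Δ + Q*Q` on `ℤ/3` is invertible (with `a = 1`). -/
example : IsUnit (TorusG0Decay.torusOp 0 (fun _ : Fin 1 => 3) 1) :=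
  isUnit_torusOp 0 (fun _ : Fin 1 => 3) (fun μ => by show 3 ≤ (0 + 1) * 3; norm_num) one_pos

end

end Literature.MathematicalPhysics.QuantumFieldTheory.Balaban1983to89.Beta.TorusG0Kernel
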